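import Summits.QuantumFields.YangMills.Theorems.SwapVirialDeficitBlowUpPeriodicTwoScaleJointLevel
import Summits.QuantumFields.YangMills.Theorems.SwapVirialDeficitBlowUpPeriodicTwoScaleLimit
import HarnessLib

/-!
# The PERIODIC massive-mode rung, brick (B1): the two-parameter limit of the level-`r` two-scale volume at a hub with null limit level
# (socket (I3‴r) of ✓`periodicPrincipalLogLimit_of_twoScale_ae`; free-hands support of ⟨stmt-QuantumFields-24196⟩ `SwapVirialDeficit.ToronSoftnessSharp`;
# LEAD memo `sfw-p2-g96-memo-24196-PM-design.md` §2 «good-threshold route» + ARCHITECTURE NOTE 14:32Z)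

At a level `r ∈ (0,1]` and a hub value `a₀ ≠ 0`, `|a₀| ≤ 1` whose limit level set `{ξ | Φ(0,0;a₀,ξ) = r}` is null, the two-scale fibre volume
`twoScaleVolumeR L r u s a₀` converges as `(u,s) → (0⁺,0⁺)` to `M_r(a₀) := μ(twoScaleLimitSet L r a₀)` (★★★ `tendsto_twoScaleVolumeR_of_null`):
the window freezes a.e. (✓w3 `ae_eventually_mem_twoScaleWindow_iff`), the deficit event freezes to `{Φ(0,0;a₀,·) < r}` on `{∀f, re y_f > 0}`
(✓`eventually_twoScaleDeficit_le_iff_level`) and is eventually FALSE when some `re y_f < 0` (★ `eventually_not_mem_twoScaleFibreR_of_neg`, PD-I's box: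
`‖Q(D_t y_f) − 1‖_F ≥ 2 > 12L²√r·t`), all inside w3's finite dominator (✓`eventually_twoScaleFibre_subset`, `r ≤ 1`).  Also: `M_r(a₀) := μ(twoScaleLimitSet L r a₀)` is measurable in `a₀`
(section measure of a jointly measurable set, ★ `measurable_measure_twoScaleLimitSet`) and bounded by the dominator's volume, and `a₀ ↦ twoScaleVolumeR L r u s a₀`
is measurable (★ `measurable_twoScaleVolumeR_hub`).  Brick (B2) (`…PeriodicFixedLRung`) picks a PRODUCT-good level, proves `M_r > 0` and closes the fixed-`L` rung.
HONEST LABEL: measure theory for a plan-level fixed-`L` rung of a DRAFT line; ⟨24196⟩ ⟨24194⟩ ⟨24197⟩ ⟨24497⟩ OPEN; own crux ⟨22884⟩ OPEN (blocked-on ⟨19935⟩);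
the Yang–Mills mass gap is NOT proved; no summit is proved by a line.
LEAD seat ym-line-sfw-p2 g96 (cell ym-idea-1, free hands), `--supports stmt-QuantumFields-24196`.  Defs: `Xi`, `muXi`, `twoScaleDom` (abbrevs), `twoScaleLimitSet`;
standard axioms, 0 `sorry`.
References: [cite: Luscher1983, §2]; [cite: GonzalezarroyoAltes1988]; [cite: tHooft1979]; [folklore].
-/

set_option autoImplicit false
set_option synthInstance.maxSize 1024

noncomputable section

open MeasureTheory Quaternion Set Filter Topology
open scoped Quaternion ENNReal BigOperators
open Literature.MathematicalPhysics.QuantumLattice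
open Literature.MathematicalPhysics.QuantumFieldTheory hiding SU2
open Summit.QuantumFields.YangMills.Theorems.SwapTwistDeficit.ToronLog

attribute [local instance] Literature.Analysis.FluidPDE.Tao2016.quatMeasurableSpace
  Literature.Analysis.FluidPDE.Tao2016.quatBorelSpace
  Literature.MathematicalPhysics.QuantumLattice.secondCountableTopology_su2

namespace Summit.QuantumFields.YangMills.Theorems.SwapVirialDeficit.BlowUpRing

open Summit.QuantumFields.YangMills.Theorems.FemtoTransferGap
open Summit.QuantumFields.YangMills.Theorems.FemtoTransferGap.TT
open Summit.QuantumFields.YangMills.Theorems.SwapVirialDeficit.ZeroModeSigma (ball3 mem_ball3_iff dilateIm dilateIm_apply)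
open Summit.QuantumFields.YangMills.Theorems.SwapVirialDeficit.ZeroModeGroup
open Summit.QuantumFields.YangMills.Theorems.SwapVirialDeficit.BlowUp (axialLetters dil3P dil3P_apply frobNorm_quatToSU2_sub_one_sq)
open Summit.QuantumFields.YangMills.Theorems.SwapVirialDeficit.TwoScaleCalculus

variable {L : ℕ} [NeZero L]

/-- The configuration space `Ξ = (ℍ×ℍ)×ℍ × (Fol L → ℍ)` of the blown-up letters `(w′, y)`. [folklore] -/
abbrev Xi (L : ℕ) [NeZero L] : Type := ((ℍ × ℍ) × ℍ) × (Fol L → ℍ)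

variable (L) in
/-- Its reference measure `vol³ ⊗ vol^{Fol L}`. [folklore] -/
abbrev muXi : Measure (Xi L) := (volume : Measure ((ℍ × ℍ) × ℍ)).prod (Measure.pi fun _ : Fol L => (volume : Measure ℍ))

/-! ## §1 Generalities: a.e. non-degeneracy, the level-`r` fibre inside the level-`1` fibre, measurability in the hub -/

/-- For a.e. `ξ` all real parts are non-zero. [folklore] -/
theorem ae_re_ne_zero :
    ∀ᵐ ξ : Xi L ∂(muXi L), (ξ.1.1.1.re ≠ 0 ∧ ξ.1.1.2.re ≠ 0 ∧ ξ.1.2.re ≠ 0) ∧ ∀ i, (ξ.2 i).re ≠ 0 := by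
  have hv : ∀ᵐ v : ℍ ∂(volume : Measure ℍ), v.re ≠ 0 := by
    rw [ae_iff]; simpa only [ne_eq, not_not] using Literature.MathematicalPhysics.QuantumLattice.volume_re_eq_zero
  have h3 : ∀ᵐ w : (ℍ × ℍ) × ℍ ∂(volume : Measure ((ℍ × ℍ) × ℍ)), w.1.1.re ≠ 0 ∧ w.1.2.re ≠ 0 ∧ w.2.re ≠ 0 := by
    have hx : ∀ᵐ w : (ℍ × ℍ) × ℍ ∂volume, w.1.1.re ≠ 0 := (Measure.quasiMeasurePreserving_fst.comp Measure.quasiMeasurePreserving_fst).ae hv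
    have hy : ∀ᵐ w : (ℍ × ℍ) × ℍ ∂volume, w.1.2.re ≠ 0 := (Measure.quasiMeasurePreserving_snd.comp Measure.quasiMeasurePreserving_fst).ae hv
    have hz : ∀ᵐ w : (ℍ × ℍ) × ℍ ∂volume, w.2.re ≠ 0 := Measure.quasiMeasurePreserving_snd.ae hv
    filter_upwards [hx, hy, hz] with w a b c using ⟨a, b, c⟩
  have hF : ∀ᵐ y : Fol L → ℍ ∂(Measure.pi fun _ : Fol L => (volume : Measure ℍ)), ∀ i, (y i).re ≠ 0 := by
    refine ae_all_iff.2 fun i => ?_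
    have h0 : (Measure.pi fun _ : Fol L => (volume : Measure ℍ)) {y : Fol L → ℍ | (y i).re = 0} = 0 :=
      Measure.pi_eval_preimage_null (fun _ : Fol L => (volume : Measure ℍ)) Literature.MathematicalPhysics.QuantumLattice.volume_re_eq_zero
    rw [ae_iff]
    simpa only [ne_eq, not_not] using h0
  filter_upwards [(Measure.quasiMeasurePreserving_fst (μ := (volume : Measure ((ℍ × ℍ) × ℍ)))
      (ν := Measure.pi fun _ : Fol L => (volume : Measure ℍ))).ae h3,
    (Measure.quasiMeasurePreserving_snd (μ := (volume : Measure ((ℍ × ℍ) × ℍ)))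
      (ν := Measure.pi fun _ : Fol L => (volume : Measure ℍ))).ae hF] with ξ h1 h2 using ⟨h1, h2⟩

/-- The level-`r` fibre lies in the level-`1` fibre when `r ≤ 1`. [folklore] -/
theorem twoScaleFibreR_subset_twoScaleFibre {r : ℝ} (hr : r ≤ 1) (u s a₀ : ℝ) : twoScaleFibreR L r u s a₀ ⊆ twoScaleFibre L u s a₀ := by
  intro q hq
  simp only [twoScaleFibreR, twoScaleFibre, periodicBlowUpSet, Set.mem_setOf_eq] at hq ⊢
  exact ⟨hq.1, hq.2.1, hq.2.2.trans (mul_le_of_le_one_left (sq_nonneg _) hr)⟩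

/-- The chart window in w3's form equals the `twoScaleRaw` form (`u ≠ 0`). [folklore] -/
theorem dil3P_scaleQ3_eq_twoScaleRaw {u : ℝ} (hu : u ≠ 0) (s : ℝ) (w : (ℍ × ℍ) × ℍ) :
    dil3P (u ^ 2 * s) (scaleQ3 u u⁻¹ w) = ((twoScaleRaw u s w.1.1, twoScaleRaw u s w.1.2), twoScaleRaw u s w.2) := by
  simp only [dil3P_apply, scaleQ3_apply, dilate_scaleQ_eq_twoScaleRaw hu]

/-- The level-`r` fibre is JOINTLY measurable in `(a₀, ξ)`. [folklore] -/
theorem measurableSet_twoScaleFibreR_joint (r u s : ℝ) :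
    MeasurableSet {z : ℝ × Xi L | z.2 ∈ twoScaleFibreR L r u s z.1} := by
  have hmap : Measurable fun z : ℝ × Xi L =>
      ((hubAt z.1 (u ^ 2), (scaleQ3 u u⁻¹ z.2.1, z.2.2)) : ℍ × (((ℍ × ℍ) × ℍ) × (Fol L → ℍ))) :=
    (measurable_hubAt.comp (measurable_fst.prodMk measurable_const)).prodMk
      (((measurable_scaleQ3 u u⁻¹).comp (measurable_fst.comp measurable_snd)).prodMk (measurable_snd.comp measurable_snd))
  exact (measurableSet_periodicBlowUpSet _ _ _ _).preimage hmap

/-- ★ `a₀ ↦ twoScaleVolumeR L r u s a₀` is measurable (hypothesis `hVm` of ✓`periodicPrincipalLogLimit_of_twoScale_ae`). [folklore] -/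
theorem measurable_twoScaleVolumeR_hub (r u s : ℝ) : Measurable fun a₀ : ℝ => twoScaleVolumeR L r u s a₀ := by
  exact measurable_measure_prodMk_left (ν := muXi L) (measurableSet_twoScaleFibreR_joint (L := L) r u s)

/-- ★ **A negative follower kills the fibre**: if `re y_f < 0` then eventually (as `(u,s) → (0⁺,0⁺)`) `ξ ∉ twoScaleFibreR L r u s a₀`
(PD-I: inside the fibre `‖Q(D_t y_f) − 1‖_F ≤ 12L²√r·t`, while `re < 0` forces `‖Q − 1‖_F ≥ 2`). [cite: Luscher1983, §2] -/
theorem eventually_not_mem_twoScaleFibreR_of_neg {r : ℝ} (hr : 0 ≤ r) (a₀ : ℝ) {ξ : Xi L} {f : Fol L} (hf : (ξ.2 f).re < 0) :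
    ∀ᶠ p : ℝ × ℝ in 𝓝[>] (0 : ℝ) ×ˢ 𝓝[>] (0 : ℝ), ξ ∉ twoScaleFibreR L r p.1 p.2 a₀ := by
  set C : ℝ := 12 * (L : ℝ) ^ 2 * Real.sqrt r with hC
  have hC0 : 0 ≤ C := by positivity
  -- eventually `u < 1` and `s < 1/(C+1)`, so `C·u²s < 1 < 2`
  have hu1 : ∀ᶠ p : ℝ × ℝ in 𝓝[>] (0 : ℝ) ×ˢ 𝓝[>] (0 : ℝ), p.1 ∈ Ioo (0 : ℝ) 1 := Filter.tendsto_fst.eventually (Ioo_mem_nhdsGT one_pos)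
  have hs1 : ∀ᶠ p : ℝ × ℝ in 𝓝[>] (0 : ℝ) ×ˢ 𝓝[>] (0 : ℝ), p.2 ∈ Ioo (0 : ℝ) (1 / (C + 1)) :=
    Filter.tendsto_snd.eventually (Ioo_mem_nhdsGT (by positivity))
  filter_upwards [hu1, hs1] with p hu hs hmem
  set t : ℝ := p.1 ^ 2 * p.2 with ht
  have ht0 : 0 < t := mul_pos (pow_pos hu.1 2) hs.1
  have hu2 : p.1 ^ 2 ≤ 1 := by nlinarith [hu.1, hu.2]
  have hts : t ≤ p.2 := by rw [ht]; nlinarith [hs.1]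
  have hCt : C * t < 2 := by
    have h1 : C * t ≤ C * p.2 := mul_le_mul_of_nonneg_left hts hC0
    have h2 : C * p.2 < 1 := by
      have := hs.2; rw [lt_div_iff₀ (by positivity)] at this; nlinarith
    linarith
  -- PD-I's box on the section
  have hsec : ξ.2 ∈ Prod.mk (scaleQ3 p.1 p.1⁻¹ ξ.1) ⁻¹' (Prod.mk (hubAt a₀ (p.1 ^ 2)) ⁻¹'
      periodicBlowUpSet L (fun _ => false) (fun _ => 1) t (r * t ^ 2)) := hmem
  obtain ⟨hfol, -, -⟩ := section_periodicBlowUpSet_subset hr ht0 _ _ _ hsec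
  obtain ⟨-, hfd⟩ := hfol f
  -- the lower bound from the negative real part
  have hv : dilateIm t (ξ.2 f) ≠ 0 := fun h => by
    have := congrArg (fun q : ℍ => q.re) h
    simp [dilateIm_apply] at this
    exact hf.ne this
  have hre : (dilateIm t (ξ.2 f)).re = (ξ.2 f).re := by simp [dilateIm_apply]
  have hsq := frobNorm_quatToSU2_sub_one_sq hv
  have hneg : (dilateIm t (ξ.2 f)).re / ‖dilateIm t (ξ.2 f)‖ < 0 := by
    rw [hre]; exact div_neg_of_neg_of_pos hf (norm_pos_iff.2 hv)
  have hnn := frobNorm_nonneg (((quatToSU2 (dilateIm t (ξ.2 f)) : SU2) : Matrix (Fin 2) (Fin 2) ℂ) - 1)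
  nlinarith [hfd, hsq, hneg, hnn, hCt]

/-! ## §2 The limit set and the two-parameter limit at a hub with null limit level -/

variable (L) in
/-- w3 g64's `(u,s)`-free dominator of the two-scale fibres (✓`twoScaleFibre_subset_dominator`), abbreviated. [folklore] -/
abbrev twoScaleDom : Set (Xi L) :=
  ((scaleQ3 1 (20 * (L : ℝ) ^ 2)⁻¹ ⁻¹' domSet4) ∪ {w : (ℍ × ℍ) × ℍ | w.1.1 = 0 ∨ w.1.2 = 0 ∨ w.2 = 0}) ×ˢ
    ((Set.univ.pi fun _ : Fol L => {y : ℍ | |y.re| < 1 ∧ ‖y.im‖ ≤ 12 * (L : ℝ) ^ 2 * Real.sqrt 1}) ∪ {y : Fol L → ℍ | ∃ i, y i = 0})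

variable (L) in
/-- ★ **The two-scale LIMIT SET at level `r` and hub `a₀`**: frozen window `|x₀|,|y′₀|,|z₀|,|re y_f| < 1`, positive followers `re y_f > 0`,
non-degenerate real parts, `Φ(0,0;a₀,·) < r`, inside the dominator. Its measure is the limit `M_r(a₀)` of the fibre volume. [cite: Luscher1983, §2] -/
def twoScaleLimitSet (r a₀ : ℝ) : Set (Xi L) :=
  {ξ | ((((|ξ.1.1.1.re| < 1 ∧ |ξ.1.1.2.re| < 1) ∧ |ξ.1.2.re| < 1) ∧ ∀ i, |(ξ.2 i).re| < 1) ∧ (∀ i, 0 < (ξ.2 i).re)) ∧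
    (((a₀, ξ) : ℝ × Xi L) ∈ sliceGood L ∧ twoScalePhi L 0 0 a₀ ξ.1 ξ.2 < r)} ∩ twoScaleDom L

/-- `Φ(0,0;a₀,ξ)` is jointly continuous in `(a₀, ξ)` on `sliceGood` (✓`continuousOn_twoScalePhi` along the slice `u = s = 0`). [folklore] -/
theorem continuousOn_twoScalePhi_zero :
    ContinuousOn (fun z : ℝ × Xi L => twoScalePhi L 0 0 z.1 z.2.1 z.2.2) (sliceGood L) := by
  have hι : Continuous fun z : ℝ × Xi L => (((0 : ℝ), ((0 : ℝ), z)) : TwoScaleParam L) := continuous_const.prodMk (continuous_const.prodMk continuous_id)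
  have hmaps : Set.MapsTo (fun z : ℝ × Xi L => (((0 : ℝ), ((0 : ℝ), z)) : TwoScaleParam L)) (sliceGood L) {p : TwoScaleParam L | p.2.2 ∈ sliceGood L} :=
    fun z hz => hz
  have h := (continuousOn_twoScalePhi (L := L)).comp hι.continuousOn hmaps
  have e : (fun z : ℝ × Xi L => twoScalePhi L 0 0 z.1 z.2.1 z.2.2) =
      (fun p : TwoScaleParam L => twoScalePhi L p.1 p.2.1 p.2.2.1 p.2.2.2.1 p.2.2.2.2) ∘ (fun z : ℝ × Xi L => (((0 : ℝ), ((0 : ℝ), z)) : TwoScaleParam L)) := rfl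
  rw [e]
  exact h

/-- The set `{(a₀, ξ) ∈ sliceGood | Φ(0,0;a₀,ξ) < r}` is open. [folklore] -/
theorem isOpen_sliceGood_inter_phi_lt (r : ℝ) :
    IsOpen (sliceGood L ∩ (fun z : ℝ × Xi L => twoScalePhi L 0 0 z.1 z.2.1 z.2.2) ⁻¹' Set.Iio r) :=
  continuousOn_twoScalePhi_zero.isOpen_inter_preimage isOpen_sliceGood isOpen_Iio

/-- The frozen window with positive followers is open. [folklore] -/
theorem isOpen_window_pos :
    IsOpen {ξ : Xi L | (((|ξ.1.1.1.re| < 1 ∧ |ξ.1.1.2.re| < 1) ∧ |ξ.1.2.re| < 1) ∧ ∀ i, |(ξ.2 i).re| < 1) ∧ ∀ i, 0 < (ξ.2 i).re} := by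
  have hre : Continuous fun q : ℍ => q.re := Quaternion.continuous_re
  have hx : Continuous fun ξ : Xi L => |ξ.1.1.1.re| := continuous_abs.comp (hre.comp (continuous_fst.comp (continuous_fst.comp continuous_fst)))
  have hy : Continuous fun ξ : Xi L => |ξ.1.1.2.re| := continuous_abs.comp (hre.comp (continuous_snd.comp (continuous_fst.comp continuous_fst)))
  have hz : Continuous fun ξ : Xi L => |ξ.1.2.re| := continuous_abs.comp (hre.comp (continuous_snd.comp continuous_fst))
  have hf : ∀ i : Fol L, Continuous fun ξ : Xi L => (ξ.2 i).re := fun i => hre.comp ((continuous_apply i).comp continuous_snd)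
  have e : {ξ : Xi L | (((|ξ.1.1.1.re| < 1 ∧ |ξ.1.1.2.re| < 1) ∧ |ξ.1.2.re| < 1) ∧ ∀ i, |(ξ.2 i).re| < 1) ∧ ∀ i, 0 < (ξ.2 i).re} =
      ((({ξ : Xi L | |ξ.1.1.1.re| < 1} ∩ {ξ | |ξ.1.1.2.re| < 1}) ∩ {ξ | |ξ.1.2.re| < 1}) ∩ ⋂ i, {ξ : Xi L | |(ξ.2 i).re| < 1}) ∩
        ⋂ i, {ξ : Xi L | 0 < (ξ.2 i).re} := by
    ext ξ; simp only [Set.mem_inter_iff, Set.mem_setOf_eq, Set.mem_iInter]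
  rw [e]
  exact ((((isOpen_lt hx continuous_const).inter (isOpen_lt hy continuous_const)).inter (isOpen_lt hz continuous_const)).inter
    (isOpen_iInter_of_finite fun i => isOpen_lt (continuous_abs.comp (hf i)) continuous_const)).inter
      (isOpen_iInter_of_finite fun i => isOpen_lt continuous_const (hf i))

/-- The frozen window with positive followers is measurable. [folklore] -/
theorem measurableSet_window_pos :
    MeasurableSet {ξ : Xi L | (((|ξ.1.1.1.re| < 1 ∧ |ξ.1.1.2.re| < 1) ∧ |ξ.1.2.re| < 1) ∧ ∀ i, |(ξ.2 i).re| < 1) ∧ ∀ i, 0 < (ξ.2 i).re} :=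
  isOpen_window_pos.measurableSet

/-- ★ The limit set is JOINTLY measurable in `(a₀, ξ)`. [folklore] -/
theorem measurableSet_twoScaleLimitSet_joint (r : ℝ) : MeasurableSet {z : ℝ × Xi L | z.2 ∈ twoScaleLimitSet L r z.1} := by
  have h1 : MeasurableSet ((Prod.snd : ℝ × Xi L → Xi L) ⁻¹'
      ({ξ : Xi L | (((|ξ.1.1.1.re| < 1 ∧ |ξ.1.1.2.re| < 1) ∧ |ξ.1.2.re| < 1) ∧ ∀ i, |(ξ.2 i).re| < 1) ∧ ∀ i, 0 < (ξ.2 i).re} ∩ twoScaleDom L)) :=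
    (measurableSet_window_pos.inter measurableSet_twoScaleDominator).preimage measurable_snd
  refine (h1.inter (isOpen_sliceGood_inter_phi_lt (L := L) r).measurableSet).congr ?_
  ext z
  simp only [twoScaleLimitSet, Set.mem_inter_iff, Set.mem_preimage, Set.mem_setOf_eq, Set.mem_Iio]
  tauto

/-- The limit set is measurable. [folklore] -/
theorem measurableSet_twoScaleLimitSet (r a₀ : ℝ) : MeasurableSet (twoScaleLimitSet L r a₀) :=
  measurable_prodMk_left (measurableSet_twoScaleLimitSet_joint (L := L) r)

/-- ★ `a₀ ↦ μ(twoScaleLimitSet L r a₀)` is measurable. [folklore] -/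
theorem measurable_measure_twoScaleLimitSet (r : ℝ) : Measurable fun a₀ : ℝ => muXi L (twoScaleLimitSet L r a₀) :=
  measurable_measure_prodMk_left (ν := muXi L) (measurableSet_twoScaleLimitSet_joint (L := L) r)

/-- The limit set lies in the dominator, so its measure is bounded by the dominator's (finite) volume. [folklore] -/
theorem measure_twoScaleLimitSet_le (r a₀ : ℝ) : muXi L (twoScaleLimitSet L r a₀) ≤ muXi L (twoScaleDom L) :=
  measure_mono Set.inter_subset_right

/-- From a two-scale eventuality with the hub moving to the one at the frozen hub `a₀`. [folklore] -/
theorem eventually_fixedHub {a₀ : ℝ} {P : (ℝ × ℝ) × ℝ → Prop} (h : ∀ᶠ q in (𝓝[>] (0 : ℝ) ×ˢ 𝓝[>] (0 : ℝ)) ×ˢ 𝓝 a₀, P q) :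
    ∀ᶠ p in 𝓝[>] (0 : ℝ) ×ˢ 𝓝[>] (0 : ℝ), P (p, a₀) :=
  h.curry.mono fun _ hp => hp.self_of_nhds

/-- The level-`r` fibre in w3's window form (`u > 0`). [folklore] -/
theorem mem_twoScaleFibreR_iff' {u : ℝ} (hu : 0 < u) (r s a₀ : ℝ) (ξ : Xi L) :
    ξ ∈ twoScaleFibreR L r u s a₀ ↔
      (dil3P (u ^ 2 * s) (scaleQ3 u u⁻¹ ξ.1) ∈ ball3 ∧ ∀ i, ‖dilateIm (u ^ 2 * s) (ξ.2 i)‖ < 1) ∧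
        twoScaleDeficit L u s a₀ ξ.1 ξ.2 ≤ r * (u ^ 2 * s) ^ 2 := by
  rw [mem_twoScaleFibreR_iff hu, dil3P_scaleQ3_eq_twoScaleRaw hu.ne', mem_ball3_iff]
  tauto

/-- ★★★ **THE TWO-PARAMETER LIMIT OF THE LEVEL-`r` TWO-SCALE VOLUME AT A HUB WITH NULL LIMIT LEVEL** (`0 < r ≤ 1`, `a₀ ≠ 0`, `|a₀| ≤ 1`):
`twoScaleVolumeR L r u s a₀ → μ(twoScaleLimitSet L r a₀)` as `(u,s) → (0⁺,0⁺)` (Mathlib's `tendsto_measure_of_ae_tendsto_indicator` with w3's dominator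
and window freezing, ✓`eventually_twoScaleDeficit_le_iff_level`, ★`eventually_not_mem_twoScaleFibreR_of_neg`). [cite: Luscher1983, §2] -/
theorem tendsto_twoScaleVolumeR_of_null {r : ℝ} (hr0 : 0 < r) (hr1 : r ≤ 1) {a₀ : ℝ} (ha : a₀ ≠ 0) (ha1 : |a₀| ≤ 1)
    (hnull : ∀ᵐ ξ : Xi L ∂(muXi L), ((a₀, ξ) : ℝ × Xi L) ∈ sliceGood L → twoScalePhi L 0 0 a₀ ξ.1 ξ.2 ≠ r) :
    Tendsto (fun p : ℝ × ℝ => twoScaleVolumeR L r p.1 p.2 a₀) (𝓝[>] (0 : ℝ) ×ˢ 𝓝[>] (0 : ℝ)) (𝓝 (muXi L (twoScaleLimitSet L r a₀))) := by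
  have hsub : ∀ᶠ p : ℝ × ℝ in 𝓝[>] (0 : ℝ) ×ˢ 𝓝[>] (0 : ℝ), twoScaleFibreR L r p.1 p.2 a₀ ⊆ twoScaleDom L :=
    (eventually_fixedHub (eventually_twoScaleFibre_subset (L := L) ha1)).mono fun p hp =>
      (twoScaleFibreR_subset_twoScaleFibre hr1 _ _ _).trans hp
  have hpos : ∀ᶠ p : ℝ × ℝ in 𝓝[>] (0 : ℝ) ×ˢ 𝓝[>] (0 : ℝ), 0 < p.1 ∧ 0 < p.2 :=
    Filter.prod_mem_prod self_mem_nhdsWithin self_mem_nhdsWithin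
  have hwin : ∀ᵐ ξ : Xi L ∂(muXi L), ∀ᶠ p : ℝ × ℝ in 𝓝[>] (0 : ℝ) ×ˢ 𝓝[>] (0 : ℝ),
      (dil3P (p.1 ^ 2 * p.2) (scaleQ3 p.1 p.1⁻¹ ξ.1) ∈ ball3 ∧ ∀ i, ‖dilateIm (p.1 ^ 2 * p.2) (ξ.2 i)‖ < 1) ↔
        (((|ξ.1.1.1.re| < 1 ∧ |ξ.1.1.2.re| < 1) ∧ |ξ.1.2.re| < 1) ∧ ∀ i, |(ξ.2 i).re| < 1) :=
    (ae_eventually_mem_twoScaleWindow_iff (L := L) a₀).mono fun ξ h => eventually_fixedHub h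
  show Tendsto (fun p : ℝ × ℝ => muXi L (twoScaleFibreR L r p.1 p.2 a₀)) (𝓝[>] (0 : ℝ) ×ˢ 𝓝[>] (0 : ℝ)) (𝓝 (muXi L (twoScaleLimitSet L r a₀)))
  refine tendsto_measure_of_ae_tendsto_indicator (𝓝[>] (0 : ℝ) ×ˢ 𝓝[>] (0 : ℝ)) (measurableSet_twoScaleLimitSet r a₀)
    (fun p => measurableSet_twoScaleFibreR r p.1 p.2 a₀) measurableSet_twoScaleDominator volume_twoScaleDominator_lt_top.ne hsub ?_
  filter_upwards [ae_re_ne_zero, hnull, hwin] with ξ hre hnl hw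
  by_cases hdom : ξ ∈ twoScaleDom L
  · by_cases hposf : ∀ i, 0 < (ξ.2 i).re
    · -- positive followers: the deficit event freezes to `Φ < r`
      have hsl : ((a₀, ξ) : ℝ × Xi L) ∈ sliceGood L := mem_sliceGood ha hre.1.1 hre.1.2.1 hre.1.2.2 hre.2
      have hdef := eventually_fixedHub (eventually_of_puncturedPlane
        (eventually_twoScaleDeficit_le_iff_level (L := L) hre.1.1 hre.1.2.1 hre.1.2.2 ha hposf r (hnl hsl)))
      filter_upwards [hpos, hw, hdef] with p hp hwp hdp
      rw [mem_twoScaleFibreR_iff' hp.1, hwp, hdp]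
      simp only [twoScaleLimitSet, Set.mem_inter_iff, Set.mem_setOf_eq]
      tauto
    · -- a non-positive, hence negative, follower: eventually outside, and outside the limit set
      obtain ⟨f, hf'⟩ := not_forall.1 hposf
      have hf : (ξ.2 f).re ≤ 0 := not_lt.1 hf'
      have hneg : (ξ.2 f).re < 0 := lt_of_le_of_ne hf (hre.2 f)
      filter_upwards [eventually_not_mem_twoScaleFibreR_of_neg hr0.le a₀ hneg] with p hp
      simp only [twoScaleLimitSet, Set.mem_inter_iff, Set.mem_setOf_eq]
      exact ⟨fun h => absurd h hp, fun h => absurd (h.1.1.2 f) (not_lt.2 hf)⟩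
  · filter_upwards [hsub] with p hp
    exact ⟨fun h => absurd (hp h) hdom, fun h => absurd h.2 hdom⟩

end Summit.QuantumFields.YangMills.Theorems.SwapVirialDeficit.BlowUpRing

end
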